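import Summits.Schanuel.Schanuel.Theorems.RootDecomp1ETwoScale04

/-!
# RootDecomp1ETwoScale — lens 2, generation 37 «TWO-SCALE E-PLANES» (items 25020 / 31409 of route 1E at n = 4 on `InTwoScaleClass`, mod NW96 Thm 1) — continuation (RootDecomp1ETwoScale05): §3 (E2) `towerPair_measure (hρ : CoveredTower ρ) (hρ0) (K D) (hNW : K = 0 ∨ NesterenkoWaldschmidt1996_thm_1)` — the transcendence measure for `(ρ, e^ρ)` with `ρ` QUANTIFIED over the class, exponent 18 (`maxHeartbeats 1600000` as in the source); §4 `FamMeasure`, `exists_trim`, `famMeasure_tower`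

(lens-2 g37 `TwoScale.lean` v2 [HOME/decomp-schanuel-lens-2/g37/TwoScale.lean v2 sha256 e81e28b8…d084, 2853 l (v1 df3b5e32…, 2509 l + §5b); own farm rc 0 · 0 warn · 0 sorry · axioms std; critic VERDICT STATUS L1776 (credit E-R17, PORT GO), v2 ACK L1780]; port by census-1 gen 16 in nine parts
`RootDecomp1ETwoScale01`–`09` — see the PORT NOTE of part 01; `--supports stmt-Schanuel-31409`; rung 0.)
-/

noncomputable section

open Complex Polynomial IntermediateField Filter

namespace Summit.Schanuel.Schanuel.Theorems.RootDecomp1ETwoScale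

open Summit.Schanuel.Schanuel.Theorems.RootDecomp1KHyper
open Summit.Schanuel.Schanuel.Theorems.RootDecomp1KHyper.HyperCell
open Summit.Schanuel.Schanuel.Theorems.RootDecomp1KGeneric
open Literature.NumberTheory.Transcendental (NesterenkoWaldschmidt1996_thm_1 weilHeight₁)

variable {K : ℕ}

/-- `1 ≤ log x` for `x ≥ 3`. -/
private theorem one_le_log_of_three_le {x : ℝ} (hx : 3 ≤ x) : 1 ≤ Real.log x := by
  rw [Real.le_log_iff_exp_le (by linarith)]
  have := Real.exp_one_lt_d9
  linarith

set_option maxHeartbeats 1600000 in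
/-- **THE MEASURE (mod NW96 Thm 1).**  At a covered tower `ρ ≠ 0`: for all `K, D` there is an explicit
`C = C(K, D, ρ) > 0` such that for every `G : Fin (K+1) → ℤ[X]` with `G_K ≠ 0` and `deg G_k ≤ D`,
`|Σ_{k ≤ K} G_k(ρ) e^{kρ}| ≥ exp(−C (1 + log relLen G)^{18})` — an algebraic-independence measure of
`(ρ, e^ρ)` POLY-LOGARITHMIC IN THE HEIGHT.  (For `K = 0` it is the transcendence measure of `ρ`; no
`hNW` is used there.) -/
theorem towerPair_measure {ρ : ℝ} (hρ : CoveredTower ρ) (hρ0 : ρ ≠ 0) (K D : ℕ)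
    (hNW : K = 0 ∨ NesterenkoWaldschmidt1996_thm_1) :
    ∃ C : ℝ, 0 < C ∧ ∀ G : Fin (K + 1) → ℤ[X], G (Fin.last K) ≠ 0 → (∀ k, (G k).natDegree ≤ D) →
      Real.exp (-(C * (1 + Real.log (relLen G)) ^ 18)) ≤
        ‖∑ k : Fin (K + 1), aeval (ρ : ℂ) (G k) * cexp ρ ^ (k : ℕ)‖ := by
  classical
  obtain ⟨N₀, hN₀⟩ := hρ
  set w : ℂ := cexp ρ with hw
  have hw0 : 0 < ‖w‖ := norm_pos_iff.mpr (Complex.exp_ne_zero _)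
  -- constants independent of `G`
  set P₀ : ℝ := (D : ℝ) * (|ρ| + 2) ^ D * max 1 ‖w‖ ^ K with hP₀
  have hP₀0 : 0 ≤ P₀ := by rw [hP₀]; positivity
  have hw1 : 0 < 1 / ‖w‖ := by positivity
  have h2K0 : (0 : ℝ) ≤ (2 : ℝ) ^ K := by positivity
  have hN00 : (0 : ℝ) ≤ N₀ := Nat.cast_nonneg N₀
  set B : ℝ := P₀ + N₀ + 2 ^ K + 1 / ‖w‖ + 9 with hB
  have hB9 : 9 ≤ B := by rw [hB]; linarith only [hP₀0, hN00, h2K0, hw1.le]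
  have hB0 : 0 < B := by linarith only [hB9]
  have hlB0 : 0 ≤ Real.log B := Real.log_nonneg (by linarith only [hB9])
  have hA1 := one_le_cA ρ
  set c₂ : ℝ := Real.log ((K : ℝ) + 1) + ((D : ℝ) + 1) * cA ρ + 2 * cA ρ with hc₂
  have hc₂0 : 0 ≤ c₂ := by
    have hx1 : 0 ≤ Real.log ((K : ℝ) + 1) :=
      Real.log_nonneg (by linarith only [(Nat.cast_nonneg K : (0 : ℝ) ≤ K)])
    have hx2 : 0 ≤ ((D : ℝ) + 1) * cA ρ := by positivity
    rw [hc₂]; linarith only [hx1, hx2, hA1]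
  set c₀ : ℝ := cNW₂ |ρ| * ((K : ℝ) + 1) ^ 5 with hc₀
  have hc₀0 : 0 ≤ c₀ := by have := cNW₂_pos (abs_nonneg ρ); rw [hc₀]; positivity
  -- `C₃`, `C₄` are introduced OPAQUELY (an `∃`-elimination), so that no tactic expands `C₄ ^ 8`
  obtain ⟨C₃, hC₃⟩ : ∃ C₃ : ℝ, C₃ = (K : ℝ) * (c₀ * (2 + c₂) ^ 2 + 4) + D + 2 := ⟨_, rfl⟩
  have hC₃0 : 0 ≤ C₃ := by
    have hx1 : 0 ≤ c₀ * (2 + c₂) ^ 2 := mul_nonneg hc₀0 (sq_nonneg _)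
    have hx2 : 0 ≤ (K : ℝ) * (c₀ * (2 + c₂) ^ 2 + 4) :=
      mul_nonneg (Nat.cast_nonneg K) (by linarith only [hx1])
    have hx3 : (0 : ℝ) ≤ D := Nat.cast_nonneg D
    rw [hC₃]; linarith only [hx2, hx3]
  obtain ⟨C₄, hC₄⟩ : ∃ C₄ : ℝ, C₄ = C₃ + Real.log B + 2 := ⟨_, rfl⟩
  have hC₄0 : 0 ≤ C₄ := by rw [hC₄]; linarith only [hC₃0, hlB0]
  have hCnn : 0 ≤ 16 * C₃ * C₄ ^ 8 := mul_nonneg (mul_nonneg (by norm_num) hC₃0) (pow_nonneg hC₄0 8)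
  refine ⟨16 * C₃ * C₄ ^ 8 + 1, hCnn.trans_lt (lt_add_one _), fun G hGK hD => ?_⟩
  set H : ℝ := relLen G with hH
  have hH1 : 1 ≤ H := one_le_relLen G hGK
  have hH0 : 0 < H := by linarith only [hH1]
  have hlH0 : 0 ≤ Real.log H := Real.log_nonneg hH1
  set h : ℝ := 1 + Real.log H with hh
  have hh1 : 1 ≤ h := by rw [hh]; linarith only [hlH0]
  have hlHh : Real.log H ≤ h := by rw [hh]; linarith only [hlH0]
  -- the Lipschitz constant `Λ = P₀ H`
  set Λ : ℝ := P₀ * H with hΛ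
  have hΛ0 : 0 ≤ Λ := by rw [hΛ]; exact mul_nonneg hP₀0 hH0.le
  have hLip : ∀ z : ℂ, ‖z - (ρ : ℂ)‖ ≤ 1 →
      ‖(sliceAt G w).eval z - (sliceAt G w).eval (ρ : ℂ)‖ ≤ Λ * ‖z - (ρ : ℂ)‖ :=
    fun z hz => lipschitz_sliceAt G hD w ρ hz
  -- the quality index `i = i(H)` and its bound `i ≤ C₃ h²`
  set i : ℝ := cIdx ρ K D H with hi
  have hiD : (D : ℝ) + 2 ≤ i := cIdx_ge ρ K D H
  have hi0 : 0 ≤ i := by linarith only [hiD, (Nat.cast_nonneg D : (0 : ℝ) ≤ D)]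
  have hcH : cHt ρ K D H = c₂ + Real.log H := by rw [hc₂, cHt]; ring
  have hκle : cKap ρ K D H ≤ c₀ * (2 + c₂) ^ 2 * h ^ 2 := by
    rw [cKap, hcH, ← hc₀]
    have h1 : 2 + (c₂ + Real.log H) ≤ (2 + c₂) * h := by
      have hx : 0 ≤ (1 + c₂) * Real.log H := mul_nonneg (by linarith only [hc₂0]) hlH0
      have e : (2 + c₂) * h = 2 + c₂ + Real.log H + (1 + c₂) * Real.log H := by rw [hh]; ring
      rw [e]; linarith only [hx]
    have h0 : 0 ≤ 2 + (c₂ + Real.log H) := by linarith only [hc₂0, hlH0]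
    have hsq : (2 + (c₂ + Real.log H)) ^ 2 ≤ ((2 + c₂) * h) ^ 2 := pow_le_pow_left₀ h0 h1 2
    calc c₀ * (2 + (c₂ + Real.log H)) ^ 2 ≤ c₀ * ((2 + c₂) * h) ^ 2 :=
          mul_le_mul_of_nonneg_left hsq hc₀0
      _ = c₀ * (2 + c₂) ^ 2 * h ^ 2 := by ring
  have hh2 : 1 ≤ h ^ 2 := one_le_pow₀ hh1
  have hile : i ≤ C₃ * h ^ 2 := by
    have hK0 : (0 : ℝ) ≤ K := Nat.cast_nonneg K
    have e0 : i = (K : ℝ) * (cKap ρ K D H + 4) + D + 2 := by rw [hi, cIdx]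
    have e1 : (K : ℝ) * (cKap ρ K D H + 4) ≤ (K : ℝ) * ((c₀ * (2 + c₂) ^ 2 + 4) * h ^ 2) := by
      refine mul_le_mul_of_nonneg_left ?_ hK0
      have : (4 : ℝ) ≤ 4 * h ^ 2 := by linarith only [hh2]
      calc cKap ρ K D H + 4 ≤ c₀ * (2 + c₂) ^ 2 * h ^ 2 + 4 * h ^ 2 := add_le_add hκle this
        _ = (c₀ * (2 + c₂) ^ 2 + 4) * h ^ 2 := by ring
    have e2 : (D : ℝ) + 2 ≤ ((D : ℝ) + 2) * h ^ 2 := le_mul_of_one_le_right (by positivity) hh2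
    calc i = (K : ℝ) * (cKap ρ K D H + 4) + ((D : ℝ) + 2) := by rw [e0]; ring
      _ ≤ (K : ℝ) * ((c₀ * (2 + c₂) ^ 2 + 4) * h ^ 2) + ((D : ℝ) + 2) * h ^ 2 := add_le_add e1 e2
      _ = C₃ * h ^ 2 := by rw [hC₃]; ring
  -- the working scale `X = ⌈e^i B H⌉`
  set X : ℕ := ⌈Real.exp i * B * H⌉₊ with hX
  have hE1 : 1 ≤ Real.exp i := by linarith only [Real.add_one_le_exp i, hi0]
  have hBH0 : 0 ≤ B * H := mul_nonneg hB0.le hH0.le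
  have hEBH' : B * H ≤ Real.exp i * B * H := by
    have e := mul_le_mul_of_nonneg_right hE1 hBH0
    rw [one_mul, ← mul_assoc] at e; exact e
  have h9BH : 9 ≤ B * H := by
    have := mul_le_mul hB9 hH1 (by norm_num) hB0.le; linarith only [this]
  have hEBH : 9 ≤ Real.exp i * B * H := by linarith only [h9BH, hEBH']
  have hEBH0 : 0 < Real.exp i * B * H := by linarith only [hEBH]
  have hEB0 : 0 < Real.exp i * B := mul_pos (Real.exp_pos i) hB0
  have hXge : Real.exp i * B * H ≤ X := Nat.le_ceil _
  have hXle : (X : ℝ) ≤ Real.exp i * B * H + 1 := (Nat.ceil_lt_add_one hEBH0.le).le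
  have hXpos : (0 : ℝ) < X := by linarith only [hEBH, hXge]
  have hBX : B ≤ X := by
    have h1 : B ≤ B * H := le_mul_of_one_le_right hB0.le hH1
    linarith only [h1, hEBH', hXge]
  have hHX : H < X := by
    have : 9 * H ≤ B * H := mul_le_mul_of_nonneg_right hB9 hH0.le
    linarith only [this, hEBH', hXge, hH0]
  have hEX : Real.exp i ≤ X := by
    have e1 : Real.exp i * 9 ≤ Real.exp i * (B * H) :=
      mul_le_mul_of_nonneg_left h9BH (Real.exp_pos i).le
    have e2 : Real.exp i ≤ Real.exp i * 9 := by linarith only [Real.exp_pos i]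
    have e3 : Real.exp i * (B * H) = Real.exp i * B * H := by ring
    linarith only [e1, e2, e3, hXge]
  -- the covering approximant at scale `X`
  have hN₀X : N₀ ≤ X := by
    have : (N₀ : ℝ) ≤ X := by
      have : (N₀ : ℝ) ≤ B := by rw [hB]; linarith only [hP₀0, h2K0, hw1.le]
      linarith only [this, hBX]
    exact_mod_cast this
  obtain ⟨r, hden, hgap, hqual⟩ := hN₀ X hN₀X
  have hXq : (X : ℝ) ≤ r.den := by exact_mod_cast hden
  have hq3 : 3 ≤ r.den := by
    have : (3 : ℝ) ≤ r.den := by linarith only [hEBH, hXge, hXq]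
    exact_mod_cast this
  have hq3r : (3 : ℝ) ≤ r.den := by exact_mod_cast hq3
  have hq0r : (0 : ℝ) < r.den := by linarith only [hq3r]
  set L : ℝ := Real.log r.den with hL
  have hL1 : 1 ≤ L := one_le_log_of_three_le hq3r
  have hL0 : 0 ≤ L := by linarith only [hL1]
  have hLX : Real.log X ≤ L := Real.log_le_log hXpos hXq
  have hiL : i ≤ L := by
    calc i = Real.log (Real.exp i) := (Real.log_exp i).symm
      _ ≤ Real.log X := Real.log_le_log (Real.exp_pos i) hEX
      _ ≤ L := hLX
  -- quality `|ρ − r| ≤ exp(−L³) ≤ exp(−iL²)`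
  have hη : |ρ - r| ≤ Real.exp (-(i * L ^ 2)) := by
    refine hqual.trans ?_
    rw [Real.exp_le_exp, neg_le_neg_iff]
    calc i * L ^ 2 ≤ L * L ^ 2 := mul_le_mul_of_nonneg_right hiL (by positivity)
      _ = L ^ 3 := by ring
  -- non-vanishing of `q^D G_K(p/q)`: `q > H ≥ len G_K ≥ |lc G_K|`
  have h0 : scaleEval (G (Fin.last K)) D r.num r.den ≠ 0 := by
    intro h0
    have hlenH : (len (G (Fin.last K)) : ℝ) ≤ H := by
      rw [hH, relLen]
      exact Finset.single_le_sum (f := fun k => (len (G k) : ℝ))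
        (fun k _ => by exact_mod_cast len_nonneg (G k)) (Finset.mem_univ _)
    have hlt : len (G (Fin.last K)) < (r.den : ℤ) := by
      have : (len (G (Fin.last K)) : ℝ) < r.den := by linarith only [hlenH, hHX, hXq]
      exact_mod_cast this
    have hne := aeval_ne_zero_of_len_lt_den hGK hlt
    have hcast := scaleEval_cast (F := ℚ) (G (Fin.last K)) (hD _) r.num r.den_nz
    rw [h0, Int.cast_zero, Rat.num_div_den] at hcast
    exact hne ((mul_eq_zero.mp hcast.symm).resolve_left
      (pow_ne_zero _ (by exact_mod_cast r.den_nz)))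
  -- thresholds at the scale
  have hΛq : Λ + 1 ≤ r.den := by
    have h1 : Λ + 1 ≤ (P₀ + 1) * H := by
      have e : (P₀ + 1) * H = P₀ * H + H := by ring
      rw [hΛ, e]; linarith only [hH1]
    have h2 : (P₀ + 1) * H ≤ B * H :=
      mul_le_mul_of_nonneg_right (by rw [hB]; linarith only [hN00, h2K0, hw1.le]) hH0.le
    linarith only [h1, h2, hEBH', hXge, hXq]
  have h2K : (2 : ℝ) ^ K ≤ r.den := by
    have : (2 : ℝ) ^ K ≤ B := by rw [hB]; linarith only [hP₀0, hN00, hw1.le]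
    linarith only [this, hBX, hXq]
  have hwq : 1 / ‖w‖ < r.den := by
    have : 1 / ‖w‖ + 9 ≤ B := by rw [hB]; linarith only [hP₀0, hN00, h2K0]
    linarith only [this, hBX, hXq]
  -- `log X ≤ C₄ h²`, `L ≤ 4 (C₄ h²)⁴`
  have hlogX : Real.log X ≤ C₄ * h ^ 2 := by
    have h1 : (X : ℝ) ≤ 2 * (Real.exp i * B * H) := by linarith only [hXle, hEBH]
    have h2 : Real.log X ≤ Real.log 2 + i + Real.log B + Real.log H := by
      calc Real.log X ≤ Real.log (2 * (Real.exp i * B * H)) := Real.log_le_log hXpos h1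
        _ = Real.log 2 + i + Real.log B + Real.log H := by
            rw [Real.log_mul two_ne_zero hEBH0.ne', Real.log_mul hEB0.ne' hH0.ne',
              Real.log_mul (Real.exp_pos i).ne' hB0.ne', Real.log_exp]
            ring
    have hl2 : Real.log 2 ≤ 1 := by have := Real.log_two_lt_d9; linarith only [this]
    have hhh2 : h ≤ h ^ 2 := by
      calc h = h * 1 := (mul_one h).symm
        _ ≤ h * h := mul_le_mul_of_nonneg_left hh1 (by linarith only [hh1])
        _ = h ^ 2 := (sq h).symm
    have e2 : Real.log B ≤ Real.log B * h ^ 2 := le_mul_of_one_le_right hlB0 hh2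
    have e4 : i ≤ C₃ * h ^ 2 := hile
    calc Real.log X ≤ Real.log 2 + i + Real.log B + Real.log H := h2
      _ ≤ h ^ 2 + C₃ * h ^ 2 + Real.log B * h ^ 2 + h ^ 2 := by
          linarith only [hl2, hh2, e4, e2, hlHh, hhh2]
      _ = C₄ * h ^ 2 := by rw [hC₄]; ring
  have hlogX0 : 0 ≤ Real.log X := Real.log_nonneg (by linarith only [hEBH, hXge])
  have hLle : L ≤ 4 * (C₄ * h ^ 2) ^ 4 :=
    hgap.trans (mul_le_mul_of_nonneg_left (pow_le_pow_left₀ hlogX0 hlogX 4) (by norm_num))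
  -- `i L² ≤ (16 C₃ C₄⁸ + 1) h^18`
  have hexp : i * L ^ 2 ≤ (16 * C₃ * C₄ ^ 8 + 1) * h ^ 18 := by
    have hL2 : L ^ 2 ≤ 16 * C₄ ^ 8 * h ^ 16 := by
      calc L ^ 2 ≤ (4 * (C₄ * h ^ 2) ^ 4) ^ 2 := pow_le_pow_left₀ hL0 hLle 2
        _ = 16 * C₄ ^ 8 * h ^ 16 := by ring
    have hh18 : 0 ≤ h ^ 18 := by positivity
    calc i * L ^ 2 ≤ (C₃ * h ^ 2) * (16 * C₄ ^ 8 * h ^ 16) :=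
          mul_le_mul hile hL2 (by positivity) (mul_nonneg hC₃0 (by positivity))
      _ = 16 * C₃ * C₄ ^ 8 * h ^ 18 := by ring
      _ ≤ (16 * C₃ * C₄ ^ 8 + 1) * h ^ 18 := by
          have e : (16 * C₃ * C₄ ^ 8 + 1) * h ^ 18 = 16 * C₃ * C₄ ^ 8 * h ^ 18 + h ^ 18 := by ring
          rw [e]; linarith only [hh18]
  -- the lower bound at this scale: `K = 0` directly, `K ≥ 1` by the clash
  have key : Real.exp (-(i * L ^ 2)) ≤ ‖∑ k : Fin (K + 1), aeval (ρ : ℂ) (G k) * w ^ (k : ℕ)‖ := by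
    rcases Nat.eq_zero_or_pos K with hK0 | hKpos
    · exact const_term_lower_bound G hK0 hD hΛ0 hLip r hq3 h0 hΛq hiD hη
    · refine le_of_not_gt fun hcon => ?_
      exact clash_at_scale (hNW.resolve_left hKpos.ne') hρ0 hKpos G hGK hD hΛ0 hLip r hq3 h0 hΛq
        h2K hwq hη hcon.le
  calc Real.exp (-((16 * C₃ * C₄ ^ 8 + 1) * h ^ 18)) ≤ Real.exp (-(i * L ^ 2)) := by
        rw [Real.exp_le_exp]; linarith only [hexp]
    _ ≤ _ := key

/-! ## §4 The Liouville kernel one level up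

A height-polylog MEASURE for the family evaluation `G ↦ Σ_k G_k(ρ) w^k` (exponent `e`) and a
`LogPowLiouville (e+1)` scale `σ` are incompatible with ANY two-level integer relation
`Σ_j σ^j · (Σ_k Gd_{j,k}(ρ) w^k) = 0`: specialise `σ ↦ b/t` at a good approximant, clear the
powers of `t`, and compare the measure (from below) with `|σ - b/t|` (from above). -/

section Kernel

/-- A height-polylog measure of exponent `e` for the evaluation of `K + 1`-member integer
families at `(ρ, w)`: for every degree bound `D` one constant `C`, the lower bound depending on
the family only through `1 + log relLen G`. -/
def FamMeasure (ρ : ℝ) (w : ℂ) (e K : ℕ) : Prop :=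
  ∀ D : ℕ, ∃ C : ℝ, 0 < C ∧ ∀ G : Fin (K + 1) → ℤ[X], (∃ k, G k ≠ 0) →
    (∀ k, (G k).natDegree ≤ D) →
      Real.exp (-(C * (1 + Real.log (relLen G)) ^ e)) ≤
        ‖∑ k : Fin (K + 1), aeval (ρ : ℂ) (G k) * w ^ (k : ℕ)‖

/-- Trimming a nonzero family to its last nonzero member (same evaluation, no larger length). -/
theorem exists_trim (G : Fin (K + 1) → ℤ[X]) (hG : ∃ k, G k ≠ 0) :
    ∃ (K' : ℕ) (hK' : K' ≤ K),
      G (Fin.castLE (by omega) (Fin.last K')) ≠ 0 ∧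
      (∀ a b : ℂ, ∑ k' : Fin (K' + 1), aeval a (G (Fin.castLE (by omega) k')) * b ^ (k' : ℕ) =
          ∑ k : Fin (K + 1), aeval a (G k) * b ^ (k : ℕ)) ∧
      relLen (fun k' : Fin (K' + 1) => G (Fin.castLE (by omega) k')) ≤ relLen G := by
  classical
  set S : Finset (Fin (K + 1)) := Finset.univ.filter fun k => G k ≠ 0 with hS
  have hSne : S.Nonempty := by
    obtain ⟨k, hk⟩ := hG
    exact ⟨k, Finset.mem_filter.mpr ⟨Finset.mem_univ _, hk⟩⟩
  set k₀ : Fin (K + 1) := S.max' hSne with hk₀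
  have hk₀mem : G k₀ ≠ 0 := (Finset.mem_filter.mp (S.max'_mem hSne)).2
  have habove : ∀ k : Fin (K + 1), k₀ < k → G k = 0 := by
    intro k hk
    by_contra h
    exact absurd (S.le_max' k (Finset.mem_filter.mpr ⟨Finset.mem_univ _, h⟩)) (not_le.mpr hk)
  refine ⟨k₀.val, by omega, ?_, ?_, ?_⟩
  · have e : Fin.castLE (by omega) (Fin.last k₀.val) = k₀ := Fin.ext (by simp)
    rw [e]; exact hk₀mem
  · intro a b
    set f : ℕ → ℂ := fun i => if h : i < K + 1 then aeval a (G ⟨i, h⟩) * b ^ i else 0 with hf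
    have h1 : ∑ k : Fin (K + 1), aeval a (G k) * b ^ (k : ℕ) =
        ∑ i ∈ Finset.range (K + 1), f i := by
      rw [← Fin.sum_univ_eq_sum_range]
      refine Finset.sum_congr rfl fun k _ => ?_
      rw [hf]; simp only [dif_pos k.2]
    have h2 : ∑ k' : Fin (k₀.val + 1), aeval a (G (Fin.castLE (by omega) k')) * b ^ (k' : ℕ) =
        ∑ i ∈ Finset.range (k₀.val + 1), f i := by
      rw [← Fin.sum_univ_eq_sum_range]
      refine Finset.sum_congr rfl fun k' _ => ?_
      have hlt : (k' : ℕ) < K + 1 := by omega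
      rw [hf]; simp only [dif_pos hlt]; rfl
    rw [h1, h2]
    apply Finset.sum_subset (Finset.range_subset_range.mpr (by omega))
    intro i hi hi'
    have hiK : i < K + 1 := Finset.mem_range.mp hi
    have hik : k₀.val < i := by
      have := Finset.mem_range.not.mp hi'; omega
    rw [hf]; simp only [dif_pos hiK]
    rw [habove ⟨i, hiK⟩ (Fin.lt_def.mpr hik), map_zero, zero_mul]
  · unfold relLen
    set g : ℕ → ℝ := fun i => if h : i < K + 1 then (len (G ⟨i, h⟩) : ℝ) else 0 with hg
    have hg0 : ∀ i, 0 ≤ g i := by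
      intro i; rw [hg]; simp only
      split_ifs
      · exact_mod_cast len_nonneg _
      · exact le_rfl
    have h1 : ∑ k : Fin (K + 1), (len (G k) : ℝ) = ∑ i ∈ Finset.range (K + 1), g i := by
      rw [← Fin.sum_univ_eq_sum_range]
      refine Finset.sum_congr rfl fun k _ => ?_
      rw [hg]; simp only [dif_pos k.2]
    have h2 : ∑ k' : Fin (k₀.val + 1), (len (G (Fin.castLE (by omega) k')) : ℝ) =
        ∑ i ∈ Finset.range (k₀.val + 1), g i := by
      rw [← Fin.sum_univ_eq_sum_range]
      refine Finset.sum_congr rfl fun k' _ => ?_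
      have hlt : (k' : ℕ) < K + 1 := by omega
      rw [hg]; simp only [dif_pos hlt]; rfl
    rw [h1, h2]
    exact Finset.sum_le_sum_of_subset_of_nonneg (Finset.range_subset_range.mpr (by omega))
      fun i _ _ => hg0 i

/-- The tower measure in `FamMeasure` form (trimmed, constant uniform over `K' ≤ K`);
hypothesis-free for `K = 0`, modulo NW96 Thm 1 for `K ≥ 1`. -/
theorem famMeasure_tower (hNW : K = 0 ∨ NesterenkoWaldschmidt1996_thm_1) {ρ : ℝ}
    (hρ : CoveredTower ρ) (hρ0 : ρ ≠ 0) : FamMeasure ρ (cexp ρ) 18 K := by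
  classical
  intro D
  have hall : ∀ K' : Fin (K + 1), ∃ C : ℝ, 0 < C ∧ ∀ G : Fin (K' + 1) → ℤ[X],
      G (Fin.last K') ≠ 0 → (∀ k, (G k).natDegree ≤ D) →
        Real.exp (-(C * (1 + Real.log (relLen G)) ^ 18)) ≤
          ‖∑ k : Fin (K' + 1), aeval (ρ : ℂ) (G k) * cexp ρ ^ (k : ℕ)‖ := by
    intro K'
    refine towerPair_measure hρ hρ0 K' D ?_
    rcases hNW with h | h
    · left; have := K'.2; omega
    · exact Or.inr h
  choose C hC0 hC using hall
  refine ⟨∑ K' : Fin (K + 1), C K', Finset.sum_pos (fun K' _ => hC0 K') Finset.univ_nonempty,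
    fun G hG hD => ?_⟩
  obtain ⟨K', hK', hlast, hsum, hrel⟩ := exists_trim G hG
  set G' : Fin (K' + 1) → ℤ[X] := fun k' => G (Fin.castLE (by omega) k') with hG'
  have hD' : ∀ k', (G' k').natDegree ≤ D := fun k' => hD _
  have hlast' : G' (Fin.last K') ≠ 0 := hlast
  have h1 := hC ⟨K', by omega⟩ G' hlast' hD'
  have hCle : C ⟨K', by omega⟩ ≤ ∑ K'' : Fin (K + 1), C K'' :=
    Finset.single_le_sum (f := fun K'' => C K'') (fun K'' _ => (hC0 K'').le) (Finset.mem_univ _)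
  have hsum0 : 0 ≤ ∑ K'' : Fin (K + 1), C K'' := Finset.sum_nonneg fun K'' _ => (hC0 K'').le
  have hH1' : 1 ≤ relLen G' := one_le_relLen G' hlast'
  have hlog : Real.log (relLen G') ≤ Real.log (relLen G) :=
    Real.log_le_log (by linarith) hrel
  have hlog0 : 0 ≤ Real.log (relLen G') := Real.log_nonneg hH1'
  have hpow : (1 + Real.log (relLen G')) ^ 18 ≤ (1 + Real.log (relLen G)) ^ 18 :=
    pow_le_pow_left₀ (by linarith) (by linarith) 18
  have hpos : 0 ≤ (1 + Real.log (relLen G')) ^ 18 := pow_nonneg (by linarith) _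
  calc Real.exp (-((∑ K'' : Fin (K + 1), C K'') * (1 + Real.log (relLen G)) ^ 18))
      ≤ Real.exp (-(C ⟨K', by omega⟩ * (1 + Real.log (relLen G')) ^ 18)) := by
        rw [Real.exp_le_exp, neg_le_neg_iff]
        calc C ⟨K', by omega⟩ * (1 + Real.log (relLen G')) ^ 18
            ≤ (∑ K'' : Fin (K + 1), C K'') * (1 + Real.log (relLen G')) ^ 18 :=
              mul_le_mul_of_nonneg_right hCle hpos
          _ ≤ (∑ K'' : Fin (K + 1), C K'') * (1 + Real.log (relLen G)) ^ 18 :=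
              mul_le_mul_of_nonneg_left hpow hsum0
    _ ≤ ‖∑ k : Fin (K' + 1), aeval (ρ : ℂ) (G' k) * cexp ρ ^ (k : ℕ)‖ := h1
    _ = ‖∑ k : Fin (K + 1), aeval (ρ : ℂ) (G k) * cexp ρ ^ (k : ℕ)‖ := by rw [hG', hsum]

end Kernel

end Summit.Schanuel.Schanuel.Theorems.RootDecomp1ETwoScale
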